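/-
Copyright: cell pub-balaban-gaps (YM BLITZ Y1, track G1), seat g1-p2 GEN 11 (unit `pub-balaban-gaps-g1-p2`).  Row (D4) NODE O, MODEL level:
the k-FREE INSTANCE — 114's per-cube conjugated coercivity of the one-scale covariant operator `Δ_W(u) + m² + a_KP_K(U)(u)` with the genuine
block-averaging projector (64's `PU`), read ALONG THE FINE ℓ¹ COMBES–THOMAS WEIGHT `ρ_j(x, a) = η·d₁(x, j)` (116: `ℓ = η`, `ℓ_B = 2d`) and with the
averaging budget supplied by 115: every constant is an explicit function of `d, a, L, κ, β, β₀, α_g, t` and of `η` ONLY through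
`2dη⁻²(cosh(|κ|η) − 1) ≤ dκ²cosh(|κ|η)` and `(η⁻¹(e^{|κ|η} − 1))² ≤ κ²e^{2|κ|η}` — bounded uniformly in the scale `K` (`η = L^{−K} ≤ 1`): the (L)
cube-level step of row (D4) NODE O on 59b–66's carrier in FORM currency (g1-plan-1 GEN 38 (σ′)(τ)(υ)), at the column weights `d(·, j)` of 104's
`hcoer`.  HONEST FRAMING: model level; the windows (66's (3.37) letters) and the transporter letters are hypothesis data; the gauge presentation
turning this into 104's `hcoer` and the GLOBAL margin of 104's END (k-dependent on this carrier per (σ)) are NOT here; Bałaban's `Δ^{(k)}(𝐔)` NOT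
constructed; (D4) instance 0∕1; NOT BetaPertH, NOT continuum, NOT Clay.
-/
import Summits.QuantumFields.BalabanUV.Gaps.D4WalkBlockFormCovOpTorus
import Summits.QuantumFields.BalabanUV.Gaps.D4WalkBlockFormAveragingTorus
import Summits.QuantumFields.BalabanUV.Gaps.D4WalkBlockFormWeightTorus

/-!
# `Gaps.D4WalkBlockFormCovOpFineTorus` — 114 at the fine ℓ¹ weight with the genuine averaging projector: per-cube conjugated coercivity of the
# one-scale covariant operator with constants free of the scale (cell pub-balaban-gaps, seat g1-p2 gen 11)

HONEST DEPENDENCY (cell pub-balaban, verbatim): continuum YM on T⁴ ⇐ BetaPertH ∧ nine spine estimates (0/9 proved); BetaPertH ⇐ (D1) ∧ (D4) ∧ CAP+tail.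

* **`conjCoercive_compress_covOp_fine`** — `a > 0`, `m² ≥ 0`, `K ≥ 1`; a fibre-saturated `S`; windows `rows, cols W^±_μ(u,x) ≤ ηβ`,
  `rows, cols Σ_μ(W⁺_μ + W⁻_μ)(u,x) ≤ η²β₀`; transporter letters `rows, cols of U(Γ_{y,x}) − 1, U(Γ_{y,x})⁻¹ − 1 ≤ α_g`; `0 < t`, `tβγ ≤ 2`,
  `γ = 2(1 + e^{2|κ|η})`: for every column site `j`, on the ball, `M·‖z‖² ≤ Re conjForm (compress (covOp u) S) κ (η·d₁(·, j)) z` with 114's `M` at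
  `ℓ = η`, `ℓ_B = 2d`, `γ_r = γ_c = e^{2d|κ|}(2α_g + α_g²)`.
WHAT IT IS NOT.  See the header; (D4) instance 0∕1; words of row (D4) UNCHANGED (`ExistsUniformAcrossSmall 𝓣_Bałaban α Rσ₀ θ₀` + `TermDomination`,
OBJECT level).

References (method only): T. Bałaban, Comm. Math. Phys. **99** (1985) 389–434 [B9], (3.8) p. 392, (3.37) p. 396, Thms 3.1–3.3 pp. 397–399, (3.42)
p. 399, (3.50)–(3.60) pp. 400–402, Cor. 3.6 p. 408, p. 409.
-/

noncomputable section

namespace Summit.QuantumFields.BalabanUV.Gaps.D4WalkBlockFormCovOpFineTorus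

open Metric Set Finset Complex Matrix
open scoped BigOperators Matrix ComplexConjugate
open Literature.MathematicalPhysics.QuantumFieldTheory.Balaban1983to89
open Literature.MathematicalPhysics.QuantumFieldTheory.Balaban1983to89.B5Prop11Lower (nsq)
open Literature.MathematicalPhysics.QuantumFieldTheory.Balaban1983to89.B6Prop22OneScaleTorus (T1)
open Summit.QuantumFields.BalabanUV.Beta.UnitLatticeLocalInverse (compress)
open Summit.QuantumFields.BalabanUV.Beta.AccretiveCombesThomas (conjForm)
open Summit.QuantumFields.BalabanUV.Gaps.D4WalkBlockCovariantPropagator (covOp)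
open Summit.QuantumFields.BalabanUV.Gaps.D4WalkBlockCovariantBlockAveraging (PU alphaK_nonneg)
open Summit.QuantumFields.BalabanUV.Gaps.D4WalkBlockFormCovOpTorus (conjCoercive_compress_covOp)
open Summit.QuantumFields.BalabanUV.Gaps.D4WalkBlockFormAveragingTorus (schur_PU_sub_Pf)
open Summit.QuantumFields.BalabanUV.Gaps.D4WalkBlockFormWeightTorus (fineWeight_shift fineWeight_block fineWeight_block' fineWeight_fibre)

variable {P : Params} {F : Type} [Fintype F] [DecidableEq F]
variable {E : Type*} [NormedAddCommGroup E] [NormedSpace ℂ E]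
variable {Wp Wm : Fin P.d → E → Site P 0 → Matrix F F ℂ} {Ug Ugi : E → Site P 0 → Matrix F F ℂ} {a msq : ℝ}

omit [NormedSpace ℂ E] in
/-- **PER-CUBE CONJUGATED COERCIVITY OF THE ONE-SCALE COVARIANT OPERATOR ALONG THE FINE ℓ¹ WEIGHT, CONSTANTS FREE OF THE SCALE.**
114's `conjCoercive_compress_covOp` at 116's weight `η·d₁(·, j)` (`ℓ = η`, `ℓ_B = 2d`) with 115's averaging budget (`γ_r = γ_c = e^{2d|κ|}(2α_g + α_g²)`) and
64's `α_K ≥ 0`. [cite: Balaban1985BackgroundPropagators, Thms 3.1–3.3 p.399, (3.42) p.399, (3.52)–(3.60) pp.400–402, Cor. 3.6 p.408, p.409] -/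
theorem conjCoercive_compress_covOp_fine (ha : 0 < a) (hmsq : 0 ≤ msq) (hK : 1 ≤ P.K)
    (S : Finset (Site P 0 × F)) (hS : ∀ p ∈ S, ∀ b : F, (p.1, b) ∈ S) {R β β₀ αg t : ℝ} (κ : ℝ)
    (hWp : ∀ μ, ∀ u ∈ ball (0 : E) R, ∀ x b, ∑ b', ‖Wp μ u x b b'‖ ≤ P.eps * β ∧ ∑ b', ‖Wp μ u x b' b‖ ≤ P.eps * β)
    (hWm : ∀ μ, ∀ u ∈ ball (0 : E) R, ∀ x b, ∑ b', ‖Wm μ u x b b'‖ ≤ P.eps * β ∧ ∑ b', ‖Wm μ u x b' b‖ ≤ P.eps * β)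
    (hW0 : ∀ u ∈ ball (0 : E) R, ∀ x b, ∑ b', ‖(∑ μ, (Wp μ u x + Wm μ u x)) b b'‖ ≤ P.eps ^ 2 * β₀ ∧
      ∑ b', ‖(∑ μ, (Wp μ u x + Wm μ u x)) b' b‖ ≤ P.eps ^ 2 * β₀)
    (hαg : 0 ≤ αg)
    (hUg : ∀ u ∈ ball (0 : E) R, ∀ x c, ∑ b, ‖(Ug u x - 1) c b‖ ≤ αg ∧ ∑ b, ‖(Ug u x - 1) b c‖ ≤ αg)
    (hUgi : ∀ u ∈ ball (0 : E) R, ∀ x c, ∑ b, ‖(Ugi u x - 1) c b‖ ≤ αg ∧ ∑ b, ‖(Ugi u x - 1) b c‖ ≤ αg)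
    (hβ : 0 ≤ β) (ht : 0 < t) (htγ : t * β * ((1 + Real.exp (2 * (|κ| * P.eps))) * 2) ≤ 2) (j : Site P 0) :
    ∀ u ∈ ball (0 : E) R, ∀ z : S → ℂ,
      ((1 - t * β * ((1 + Real.exp (2 * (|κ| * P.eps))) * 2) / 2)
          * (min 8 (a * (1 - (((P.L : ℝ)) ^ 2)⁻¹)) - (0 + 2 * P.d * (P.eps⁻¹ ^ 2 * (Real.cosh (|κ| * P.eps) - 1))
              + B1RG242Torus.α P a P.K * (Real.cosh (|κ| * (2 * P.d)) - 1)))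
        - ((β₀ + B1RG242Torus.α P a P.K * (Real.exp (|κ| * (2 * P.d)) * (2 * αg + αg ^ 2)))
            + (β₀ + B1RG242Torus.α P a P.K * (Real.exp (|κ| * (2 * P.d)) * (2 * αg + αg ^ 2)))) / 2
        - (∑ _ι : Fin P.d ⊕ Fin P.d, β) / (2 * t)
        - t * β * ((1 + Real.exp (2 * (|κ| * P.eps))) * (2 * (B1RG242Torus.α P a P.K * Real.exp (|κ| * (2 * P.d)))
            + 4 * P.d * (P.eps⁻¹ * (Real.exp (|κ| * P.eps) - 1)) ^ 2)) / 2) * nsq z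
      ≤ (conjForm (compress (covOp P F Wp Wm (PU P F Ug Ugi) a msq u) S) κ (fun e : S => P.eps * T1 P 0 (e : Site P 0 × F).1 j) z).re := by
  have hsch := schur_PU_sub_Pf (Ug := Ug) (Ugi := Ugi) hαg hUg hUgi (fun p : Site P 0 × F => P.eps * T1 P 0 p.1 j)
    (fun p q h => fineWeight_block' (F := F) j p q h) S κ
  exact conjCoercive_compress_covOp (PU := PU P F Ug Ugi) ha hmsq hK (alphaK_nonneg P ha.le hK) P.eps_pos.le
    (fun p : Site P 0 × F => P.eps * T1 P 0 p.1 j) (fun p μ => fineWeight_shift (F := F) j p μ)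
    (fun x x' b h => fineWeight_block (F := F) j x x' b h) (fun x b b' => fineWeight_fibre (F := F) j x b b') S hS κ hWp hWm hW0
    (fun u hu e => (hsch u hu e).1) (fun u hu e => (hsch u hu e).2) hβ ht htγ

end Summit.QuantumFields.BalabanUV.Gaps.D4WalkBlockFormCovOpFineTorus

end
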